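import Mathlib
import Summits.AtomisticToContinuum.Crystallization.Theses.ChessboardParticlePlanes
import Summits.AtomisticToContinuum.Crystallization.Theorems.ChessboardParticlePlanesEnergeticGlue
import Summits.AtomisticToContinuum.Crystallization.Theorems.CrystalLocalRigidityAssembly
import Summits.AtomisticToContinuum.Crystallization.Theorems.ExcessDecayLiouvilleCrysEnergyLimit
import Summits.AtomisticToContinuum.Crystallization.Theorems.PalmUnimodularRigidityCrysPeriodicBddBelow
import Summits.AtomisticToContinuum.Crystallization.Theorems.ChessboardParticlePlanesLjLaminarWindowsEnergyGapReduction
import Summits.AtomisticToContinuum.Crystallization.Theorems.ChessboardParticlePlanesLjLaminarWindowsNSF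
import Summits.AtomisticToContinuum.Crystallization.Theorems.ChessboardParticlePlanesLjLaminarWindowsAllGroundStates
import Summits.AtomisticToContinuum.Crystallization.Theorems.ChessboardParticlePlanesLayerConfinedCompetitors
import Summits.AtomisticToContinuum.Crystallization.Theorems.ChessboardParticlePlanesLayerConfinedCompetitorsPeriodisation
import Literature.Geometry.DiscreteGeometry.FejesTothKissingTwelve
import HarnessLib

/-!
# STRATEGY CENSUS sketch — crux `LjLaminarWindows` (stmt-AtomisticToContinuum-6711), strategist s1

Lean companion of `STRATEGY-CENSUS.md` (crux-strategist seat
`planner-cstrat-stmt-AtomisticToContinuum-6711-s1-0`, 2026-08-17).  Every signature named in the census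
elaborates here; the one THEOREM of the file (`closes_without_LjLaminarWindows`, sorry-free) is the
kernel-checked form of the census's route-level finding: the deciding chain of route
`ChessboardParticlePlanes` consumes the crux ONLY through the support item
`LayerConfinedCompetitors` (stmt-6712), so the chain closes from
`LjPlaneChessboard ∧ LjBilayerHcp ∧ LayerConfinedCompetitors ∧ PeriodicWindows` with no laminarity of
ground states at all.

Sections: §R route-level finding · §T transfer (sticky spheres, `d = 3`; Theil, `d = 2`) ·
§S strengthenings · §D decompositions · §N negation.  No `sorry` anywhere; statements that are open
are `def … : Prop`, never theorems.
-/

noncomputable section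

open Filter
open Literature.MathematicalPhysics.StatisticalMechanics
open Summit.AtomisticToContinuum.Crystallization.Theses.ChessboardParticlePlanes

namespace Summit.AtomisticToContinuum.Crystallization.Cruxes.LjLaminarWindows.Strategist

/-- Ambient space `ℝ³`. -/
abbrev E3 := EuclideanSpace ℝ (Fin 3)

/-- `e* = ⨅_Q e_LJ(Q)` over periodic configurations of `ℝ³`. -/
def eStar : ℝ := ⨅ Q : PeriodicConfiguration 3, Q.energyPerParticle lennardJones

/-- The laminarity predicate of the crux, verbatim: the closed `L`-ball of `y` around `y i` is
`η`-laminar (some linear isometry `A`, some `3/4`-separated height set `T`). -/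
def LaminarAt {M : ℕ} (y : Fin M → E3) (i : Fin M) (L η : ℝ) : Prop :=
  ∃ (A : E3 →ₗᵢ[ℝ] E3) (T : Set ℝ), (∀ t ∈ T, ∀ t' ∈ T, t ≠ t' → (3 : ℝ) / 4 ≤ |t - t'|) ∧
    ∀ j : Fin M, dist (y j) (y i) ≤ L → ∃ t ∈ T, |(A (y j - y i)) 2 - t| ≤ η

/-- The same predicate for a point SET (periodic configurations). -/
def SetLaminarAt (X : Set E3) (p : E3) (L η : ℝ) : Prop :=
  ∃ (A : E3 →ₗᵢ[ℝ] E3) (T : Set ℝ), (∀ t ∈ T, ∀ t' ∈ T, t ≠ t' → (3 : ℝ) / 4 ≤ |t - t'|) ∧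
    ∀ q ∈ X, dist q p ≤ L → ∃ t ∈ T, |(A (q - p)) 2 - t| ≤ η

/-- The stuck stub S9♯ (`stub_allGroundStatesOneWindow`, crux-equivalent by
`LjLaminarWindowsSketch.LjLaminarWindows_iff_allGroundStates`), in the notation above. -/
def S9sharp : Prop :=
  ∀ η : ℝ, 0 < η → ∀ L : ℝ, ∃ᶠ N in atTop, ∀ y : Fin N → E3, IsGroundState lennardJones y →
    ∃ i : Fin N, LaminarAt y i L η

/-- S9♯ in this file's notation is literally the right-hand side of the tree equivalence. -/
example : S9sharp ↔
    (∀ η : ℝ, 0 < η → ∀ L : ℝ, ∃ᶠ N in Filter.atTop, ∀ y : Fin N → EuclideanSpace ℝ (Fin 3),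
      IsGroundState lennardJones y →
        ∃ (i : Fin N) (A : EuclideanSpace ℝ (Fin 3) →ₗᵢ[ℝ] EuclideanSpace ℝ (Fin 3)) (T : Set ℝ),
          (∀ t ∈ T, ∀ t' ∈ T, t ≠ t' → (3 : ℝ) / 4 ≤ |t - t'|) ∧
          (∀ j : Fin N, dist (y j) (y i) ≤ L → ∃ t ∈ T, |(A (y j - y i)) 2 - t| ≤ η)) :=
  Iff.rfl

/-- … and hence equivalent to the crux (tree theorem, p138990). -/
example : LjLaminarWindows ↔ S9sharp :=
  Summit.AtomisticToContinuum.Crystallization.Theorems.LjLaminarWindowsSketch.LjLaminarWindows_iff_allGroundStates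

/-! ## §R  Route-level finding: `closes` needs only `LayerConfinedCompetitors` (6712)

The route's `Assembly`/`closes` use `LjLaminarWindows` once: `LaminarPeriodisation` (6713, proved)
turns it into `LayerConfinedCompetitors` (6712, open support item), which `EnergeticGlue` (6714,
proved) combines with the two energetic cruxes.  Hence the following sorry-free deciding chain in
which the crux does not occur. -/

/-- **The deciding chain without the crux.**  `LjPlaneChessboard → LjBilayerHcp →
LayerConfinedCompetitors → PeriodicWindows → Crystallization`, from the landed
`energeticGlue_proof` (6714), `crysPeriodicBddBelow_proof` (0714), `crysEnergyLimit_proof` (0626),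
`HullCriterion_holds` (3243) and the assembly lemma of stmt-0622. [folklore] -/
theorem closes_without_LjLaminarWindows (hRP : LjPlaneChessboard) (h2D : LjBilayerHcp)
    (hLCC : LayerConfinedCompetitors) (hWin : PeriodicWindows) : _root_.Crystallization := by
  obtain ⟨a, h, ha, hh, -, -, -, -, hLeast⟩ :=
    Summit.AtomisticToContinuum.Crystallization.Theorems.energeticGlue_proof hRP h2D hLCC
      Summit.AtomisticToContinuum.Crystallization.Theorems.crysPeriodicBddBelow_proof
  exact Literature.StatMech.crystallization_of_isLeast_tendsto_isCrystallizing
    ⟨⟨_, hLeast⟩, Summit.AtomisticToContinuum.Crystallization.Theorems.crysEnergyLimit_proof,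
      HullCriterion_holds hWin⟩

/-- What the route actually needs from item 6711, by name: the support item 6712. -/
example (hLam : LjLaminarWindows) : LayerConfinedCompetitors :=
  Summit.AtomisticToContinuum.Crystallization.Theorems.LayerConfined.layerConfinedCompetitors_of_ljLaminarWindows
    hLam

/-! ## §T  Transfer — the solved sibling's version of exactly this step

Sibling: STICKY unit balls in `ℝ³` (Heitmann–Radin potential: hard core `2`, contact energy `−1` at
distance exactly `2`, zero beyond; Hales's normalisation).  Ground states = packings maximising the
number of touching pairs.  The analogue of S9♯ ("every large max-contact packing has an exactly
laminar particle-centred `L`-window, planes `≥ 3/2` apart" — ideal spacing `2√(2/3) ≈ 1.633`) follows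
from T1 (defect counting: kissing bound `12` is TIGHT per particle + Bezdek 2012 Thm 1.1:
`6n − 7.862 n^{2/3} < C(n) < 6n − 0.695 n^{2/3}`, arXiv:1102.1198) + pigeonhole + T2 (local Fejes
Tóth–Hales: an all-twelve ball is a Barlow piece; Hales 2012 Thm 1/3, tree facts
`Literature.Geometry.DiscreteGeometry.Hales2012_kissingTwelve`, `HalesDSP_layerPackings`). -/

/-- Number of ordered touching pairs of a finite family of unit-ball centres (Hales units). -/
def contactPairs (V : Finset E3) : ℕ :=
  ((V ×ˢ V).filter fun p => p.1 ≠ p.2 ∧ dist p.1 p.2 = 2).card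

/-- Contact degree of `u` in `V`. -/
def contactDegree (V : Finset E3) (u : E3) : ℕ := (V.filter fun v => dist v u = 2).card

/-- A finite unit-ball packing maximising the number of contacts among packings of the same
cardinality: the sticky-sphere ground states. -/
def IsMaxContactPacking (V : Finset E3) : Prop :=
  Literature.Geometry.DiscreteGeometry.IsUnitBallPacking (V : Set E3) ∧
    ∀ W : Finset E3, Literature.Geometry.DiscreteGeometry.IsUnitBallPacking (W : Set E3) → W.card = V.card →
      contactPairs W ≤ contactPairs V

/-- **The sibling statement** (S9♯ for sticky spheres, exact laminarity `η = 0` even). -/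
def StickyLaminarWindows : Prop :=
  ∀ L : ℝ, ∃ n₀ : ℕ, ∀ V : Finset E3, IsMaxContactPacking V → n₀ ≤ V.card →
    ∃ u ∈ V, ∃ (A : E3 →ₗᵢ[ℝ] E3) (T : Set ℝ), (∀ t ∈ T, ∀ t' ∈ T, t ≠ t' → (3 : ℝ) / 2 ≤ |t - t'|) ∧
      ∀ v ∈ V, dist v u ≤ L → ∃ t ∈ T, (A (v - u)) 2 = t

/-- **T1 (sibling, defect counting)**: in a max-contact packing all but `O(n^{2/3})` balls touch
twelve others — because the per-particle bound `12` (kissing number) is attained in the bulk of the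
fcc trial packing (Bezdek 2012, Thm 1.1 (iii): `C(n) > 6n − ∛486 · n^{2/3}`), so
`#{deg < 12} ≤ 12n − 2C(n) < 2∛486 · n^{2/3}`. -/
def StickyDefectCount : Prop :=
  ∃ C : ℝ, ∀ V : Finset E3, IsMaxContactPacking V →
    ((V.filter fun u => contactDegree V u < 12).card : ℝ) ≤ C * (V.card : ℝ) ^ ((2 : ℝ) / 3)

/-- **T2 (sibling, local Fejes Tóth–Hales gluing)**: if every ball within `L'` of `u` touches
twelve others then the `L`-window of `u` lies on parallel planes `≥ 3/2` apart (each shell is the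
fcc or hcp pattern, Hales 2012 Thm 3 + Lemma 9; patterns glue to hexagonal layers, DSP §1.3). -/
def StickyLocalBarlow : Prop :=
  ∀ L : ℝ, ∃ L' : ℝ, ∀ V : Finset E3, Literature.Geometry.DiscreteGeometry.IsUnitBallPacking (V : Set E3) →
    ∀ u ∈ V, (∀ v ∈ V, dist v u ≤ L' → contactDegree V v = 12) →
      ∃ (A : E3 →ₗᵢ[ℝ] E3) (T : Set ℝ), (∀ t ∈ T, ∀ t' ∈ T, t ≠ t' → (3 : ℝ) / 2 ≤ |t - t'|) ∧
        ∀ v ∈ V, dist v u ≤ L → ∃ t ∈ T, (A (v - u)) 2 = t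

/-- Soft twelve-coordination of particle `i` of `y` at tolerance `t₀`: its neighbourhood up to
`5/4` of the shell scale `s` is two-way `t₀ s`-matched with a scaled twelve-point kissing
arrangement `s • S` (any of the continuum of kissing arrangements — no pattern is asked). -/
def SoftTwelve (t₀ : ℝ) {N : ℕ} (y : Fin N → E3) (i : Fin N) : Prop :=
  ∃ (s : ℝ) (S : Finset E3), 0 < s ∧ S.card = 12 ∧ (∀ v ∈ S, ‖v‖ = 2) ∧
    (∀ v ∈ S, ∀ w ∈ S, v ≠ w → 2 ≤ dist v w) ∧
    (∀ v ∈ S, ∃ j : Fin N, dist (y j - y i) (s • v) ≤ t₀ * s) ∧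
    (∀ j : Fin N, j ≠ i → dist (y j) (y i) ≤ 5 / 4 * (2 * s) → ∃ v ∈ S, dist (y j - y i) (s • v) ≤ t₀ * s)

/-- **T1 transferred to Lennard-Jones — the step that does NOT transfer.**  The LJ analogue of the
defect count: along ground states all but `o(N)` particles are softly twelve-coordinated.  For
sticky spheres T1 is free because the one-centre optimum (twelve contacts) is also the bulk optimum;
for Lennard-Jones the one-centre optimum is the icosahedral shell, which beats both close-packed
shells (certified: `IcosahedralClusters_holds`, `E_ico(13) < −3.677 < −3.409 < E_fcc/hcp-shell(13)`)
and cannot tile space (`TetrahedralFrustration_holds`, `5θ < 2π < 6θ`), so no per-particle count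
follows from `E(N)/N → e*`; this is item SoftTwelveCoordination (0750, closed·moot) / the priced
stub `stub_firstShellLayeringPrice` of line `birth` on 14293 — open. -/
def LjSoftTwelveCount : Prop :=
  ∀ t₀ : ℝ, 0 < t₀ → ∀ x : (N : ℕ) → (Fin N → E3), (∀ N, IsGroundState lennardJones (x N)) →
    Tendsto (fun N : ℕ => (Nat.card {i : Fin N // ¬ SoftTwelve t₀ (x N) i} : ℝ) / N) atTop (nhds 0)

/-! ## §S  Strengthenings `S⁺ ⇒ crux` -/

/-- **S1** = item 14293 `LaminarSixThreeThree.LjLaminarity` (a.e. laminarity, all `N`), verbatim;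
`S1 → crux` is the tree theorem `LjLaminarWindowsSketch.LjLaminarWindows_of_laminarity`. -/
def S1_Laminarity : Prop :=
  ∀ t R : ℝ, 0 < t → 0 < R → ∀ x : (N : ℕ) → (Fin N → EuclideanSpace ℝ (Fin 3)),
    (∀ N, IsGroundState lennardJones (x N)) →
    Filter.Tendsto (fun N : ℕ => (Nat.card {i : Fin N // ¬ (∃ n : EuclideanSpace ℝ (Fin 3),
      ‖n‖ = 1 ∧ ∃ c : ℤ → ℝ, (∀ k : ℤ, c k + 3 / 4 ≤ c (k + 1)) ∧ ∀ j : Fin N,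
        dist (x N j) (x N i) ≤ R → ∃ k : ℤ, |inner ℝ (x N j - x N i) n - c k| ≤ t)} : ℝ) / N)
      Filter.atTop (nhds 0)

example (h : S1_Laminarity) : LjLaminarWindows :=
  Summit.AtomisticToContinuum.Crystallization.Theorems.LjLaminarWindowsSketch.LjLaminarWindows_of_laminarity h

/-- **S2 (Gap)**, verbatim the hypothesis of the tree theorem
`LjLaminarWindowsSketch.LjLaminarWindows_of_nonLaminarEnergyGap` (p137775): uniformly non-laminar
`7/10`-separated finite configurations are gapped above `e*`.  Ground-state-free, uniform. -/
def S2_NonLaminarEnergyGap : Prop :=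
  ∀ L η : ℝ, 0 < η → ∃ c : ℝ, 0 < c ∧ ∃ M₀ : ℕ, ∀ M : ℕ, M₀ ≤ M →
    ∀ y : Fin M → EuclideanSpace ℝ (Fin 3),
    (∀ j k : Fin M, j ≠ k → (7 : ℝ) / 10 ≤ dist (y j) (y k)) →
    (¬ ∃ (i : Fin M) (A : EuclideanSpace ℝ (Fin 3) →ₗᵢ[ℝ] EuclideanSpace ℝ (Fin 3)) (T : Set ℝ),
        (∀ t ∈ T, ∀ t' ∈ T, t ≠ t' → (3 : ℝ) / 4 ≤ |t - t'|) ∧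
        (∀ j : Fin M, dist (y j) (y i) ≤ L → ∃ t ∈ T, |(A (y j - y i)) 2 - t| ≤ η)) →
    ((⨅ Q : PeriodicConfiguration 3, Q.energyPerParticle lennardJones) + c) * M ≤
      interactionEnergy lennardJones y

example (h : S2_NonLaminarEnergyGap) : LjLaminarWindows :=
  Summit.AtomisticToContinuum.Crystallization.Theorems.LjLaminarWindowsSketch.LjLaminarWindows_of_nonLaminarEnergyGap
    h

/-- **S3 (PeriodicGap)**: the same gap asked only of PERIODIC `7/10`-separated configurations none
of whose particle-centred `L`-windows is `η`-laminar.  `S3 → S2` is a periodisation-with-seams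
lemma (§D, D1); S3 is the cleanest form of the variational core: "no everywhere-non-laminar periodic
structure comes within `c(L, η)` of the periodic infimum". -/
def S3_PeriodicNonLaminarGap : Prop :=
  ∀ L η : ℝ, 0 < η → ∃ c : ℝ, 0 < c ∧ ∀ Q : PeriodicConfiguration 3,
    (∀ p ∈ Q.points, ∀ q ∈ Q.points, p ≠ q → (7 : ℝ) / 10 ≤ dist p q) →
    (¬ ∃ p ∈ Q.points, SetLaminarAt Q.points p L η) →
    eStar + c ≤ Q.energyPerParticle lennardJones

/-- **S4 (priced laminarity, all finite configurations)**: the radius-`L` version of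
`stub_firstShellLayeringPrice` (line `birth` on 14293): `N e* + γ · #{non-(η,L)-laminar} ≤ 𝓔(y)` for
EVERY injective `y` (no boundary allowance needed: far-copies amplification, cf.
`ChargedEnergyGapNegative.noBoundary_of_gapWith`).  `S4 ⇒ S2` (all bad ⇒ `#bad = M`) and
`S4 ⇒ S1` (`E(N) − N e* = o(N)`). -/
def S4_LaminarityPrice : Prop :=
  ∀ L η : ℝ, 0 < η → ∃ γ : ℝ, 0 < γ ∧ ∀ (N : ℕ) (y : Fin N → E3), Function.Injective y →
    (N : ℝ) * eStar + γ * (Nat.card {i : Fin N // ¬ LaminarAt y i L η} : ℝ) ≤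
      interactionEnergy lennardJones y

/-- **S0 (the weakest statement containing the difficulty)**: the non-strict, scale-free shadow of
all of S1–S4 AND of the route's own support item 6712 — the laminar class reaches the periodic
infimum: `⨅_{laminar Q} e(Q) = e*`.  This is `LayerConfinedCompetitors` (6712) up to the constants
`2/3`, `3/4`; every strategy for 6711 proves it on the way (`LaminarPeriodisation`, proved). -/
def S0_LaminarClassOptimal : Prop :=
  ∀ ε : ℝ, 0 < ε → ∃ Q : PeriodicConfiguration 3,
    (∀ x ∈ Q.points, ∀ y ∈ Q.points, x ≠ y → (2 : ℝ) / 3 ≤ dist x y) ∧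
    (∀ x ∈ Q.points, ∀ y ∈ Q.points, x 2 ≠ y 2 → (3 : ℝ) / 4 ≤ |x 2 - y 2|) ∧
    Q.energyPerParticle lennardJones ≤ eStar + ε

example : S0_LaminarClassOptimal ↔ LayerConfinedCompetitors := Iff.rfl

/-! ## §D  Decompositions (typed splits) -/

/-- **D1**: `S3 → S2`, periodisation with seams (cubic periodisation of a uniformly non-laminar
finite `y` at period `2Σ‖yⱼ‖ + 2`, `ChargedEnergyGapNegative.periodise`: cross-copy terms `≤ 0`,
and a window of the periodised set centred at a particle CONTAINS that particle's window in `y`,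
so it is non-laminar too — supersets of non-laminar sets are non-laminar).  Provable now, size M.
With the landed `S2 → crux` this is the split `crux ⇐ S3 ∧ D1`; the piece `S3` keeps the whole
difficulty. -/
def D1_PeriodisationStep : Prop := S3_PeriodicNonLaminarGap → S2_NonLaminarEnergyGap

/-- **D2** (on the board as line `birth` of crux 14293): first-shell price (stub A) and coherence
price (stub B) give S1, and S1 gives the crux.  Stub A, verbatim up to notation: -/
def D2a_FirstShellLayeringPrice : Prop :=
  ∀ t₀ : ℝ, 0 < t₀ → ∃ γ : ℝ, 0 < γ ∧ ∀ (N : ℕ) (y : Fin N → E3), Function.Injective y →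
    (N : ℝ) * eStar + γ * (Nat.card {i : Fin N // ¬ LaminarAt y i (3 / 2) t₀} : ℝ) ≤
      interactionEnergy lennardJones y

/-- Stub B of `birth` (coherence price), verbatim up to notation. -/
def D2b_CoherencePrice : Prop :=
  ∀ t R : ℝ, 0 < t → 0 < R → ∃ t₀ γ C : ℝ, 0 < t₀ ∧ 0 < γ ∧ 0 ≤ C ∧
    ∀ (N : ℕ) (y : Fin N → E3), Function.Injective y →
      γ * (Nat.card {i : Fin N // ¬ LaminarAt y i R t} : ℝ) ≤
        (interactionEnergy lennardJones y - N * eStar) +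
          C * (Nat.card {i : Fin N // ¬ LaminarAt y i (3 / 2) t₀} : ℝ)

/-- **D3** (route level, the split WITH teeth — for the tenure planner, outside this seat's remit):
`closes` factors through 6712 (`closes_without_LjLaminarWindows` above), so the honest item set is
`{LjPlaneChessboard, LjBilayerHcp, LayerConfinedCompetitors, PeriodicWindows}` with 6711 demoted to
ONE sufficient line for 6712 (`LaminarPeriodisation`, proved) next to the trivial one
(`HcpPeriodicMinimiser → 6712`, `LayerConfined.layerConfinedCompetitors_of_isLeast_hcp`). -/
def D3_RouteCruxes : Prop :=
  LjPlaneChessboard ∧ LjBilayerHcp ∧ LayerConfinedCompetitors ∧ PeriodicWindows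

example (h : D3_RouteCruxes) : _root_.Crystallization :=
  closes_without_LjLaminarWindows h.1 h.2.1 h.2.2.1 h.2.2.2

/-! ## §N  Negation -/

/-- What a refutation of the crux must exhibit (negation of S9♯, pushed through the quantifiers):
ONE thickness, ONE radius, and for all large `N` ONE ground state with no laminar window. -/
def N1_Counterexample : Prop :=
  ∃ η : ℝ, 0 < η ∧ ∃ L : ℝ, ∀ᶠ N in atTop, ∃ y : Fin N → E3, IsGroundState lennardJones y ∧
    ∀ i : Fin N, ¬ LaminarAt y i L η

/-- `¬ S9♯ ↔ N1` (filter bookkeeping: `Filter.not_frequently`, `not_forall`, `not_exists`). -/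
example : ¬ S9sharp ↔ N1_Counterexample := by
  unfold S9sharp N1_Counterexample
  push Not
  exact Iff.rfl

/-- The ground-state-free negative that WOULD have teeth (it kills S2/S3/S4 and the variational
upstream, not the crux): an everywhere-non-laminar periodic structure at or below relaxed hcp.
Numerically absent: σ-phase +8.5 %, A15 +12.0 %, C15 +18 %, best random non-laminar cell (m ≤ 8)
+7.2 % above e(hcp) = −0.7176 (kit j016903, ideator 2; lead c13 `tcp_gap.py`); bcc (+4.3 %) is
(110)-laminar (spacing 0.777 ≥ 3/4). -/
def N2_VariationalNegative : Prop :=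
  ∃ L η : ℝ, 0 < η ∧ ∀ c : ℝ, 0 < c → ∃ Q : PeriodicConfiguration 3,
    (∀ p ∈ Q.points, ∀ q ∈ Q.points, p ≠ q → (7 : ℝ) / 10 ≤ dist p q) ∧
    (¬ ∃ p ∈ Q.points, SetLaminarAt Q.points p L η) ∧
    Q.energyPerParticle lennardJones < eStar + c

/-- `N2 → ¬ S3` (it is literally the negation of the periodic gap). -/
example (h : N2_VariationalNegative) : ¬ S3_PeriodicNonLaminarGap := by
  rintro hS
  obtain ⟨L, η, hη, hN⟩ := h
  obtain ⟨c, hc, hQ⟩ := hS L η hη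
  obtain ⟨Q, hsep, hnl, hlt⟩ := hN c hc
  exact absurd (hQ Q hsep hnl) (not_le.mpr hlt)

end Summit.AtomisticToContinuum.Crystallization.Cruxes.LjLaminarWindows.Strategist

end
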